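import Mathlib

/-!
# Set/tuple sign transport for maximal minors

Two injective enumerations `f g : Fin k → ι` of the same column set `Set.range f = Set.range g`
differ by a permutation `σ` of `Fin k`, so the corresponding maximal minors
`det (M.submatrix id f)` and `det (M.submatrix id g)` agree up to the sign of `σ`.
Only the disjunction "equal or negated" is recorded here. [folklore]
-/

set_option linter.dupNamespace false

namespace Summit.MatrixMultiplication.MatrixMultiplication.Theorems.CondensationSound

/-- Two injective maps `Fin k → ι` with the same range differ by a permutation of `Fin k`:
there is `σ` with `f ∘ σ = g` pointwise. [folklore] -/
theorem exists_perm_comp_eq_of_range_eq_transport {k : ℕ} {ι : Type} (f g : Fin k → ι)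
    (hf : Function.Injective f) (hg : Function.Injective g) (hfg : Set.range f = Set.range g) :
    ∃ σ : Equiv.Perm (Fin k), ∀ x, f (σ x) = g x := by
  refine ⟨(Equiv.ofInjective g hg).trans
    ((Equiv.setCongr hfg.symm).trans (Equiv.ofInjective f hf).symm), fun x => ?_⟩
  simp only [Equiv.trans_apply]
  rw [Equiv.apply_ofInjective_symm hf]
  simp [Equiv.setCongr_apply, Equiv.ofInjective_apply]

/-- Set/tuple sign transport: two injective enumerations of the same column set give the same
maximal minor up to sign. [folklore] -/
theorem stub_transport :
    ∀ (R : Type) [CommRing R] (k : ℕ) (ι : Type) (M : Matrix (Fin k) ι R) (f g : Fin k → ι),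
      Function.Injective f → Function.Injective g → Set.range f = Set.range g →
      (M.submatrix id g).det = (M.submatrix id f).det ∨
        (M.submatrix id g).det = -(M.submatrix id f).det := by
  intro R _ k ι M f g hf hg hfg
  obtain ⟨σ, hσ⟩ := exists_perm_comp_eq_of_range_eq_transport f g hf hg hfg
  have hM : M.submatrix id g = (M.submatrix id f).submatrix id ⇑σ := by
    ext i j
    simp [Matrix.submatrix_apply, hσ]
  rw [hM, Matrix.det_permute']
  rcases Int.units_eq_one_or (Equiv.Perm.sign σ) with h | h
  · left
    simp [h]
  · right
    simp [h]

end Summit.MatrixMultiplication.MatrixMultiplication.Theorems.CondensationSound
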